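import Summits.CriticalPhenomena.SAWScalingLimit.Theses.SAWRestrictionRigidity
import Literature.Probability.RandomPlanarGeometry.ConformalRestrictionProofs

/-!
# Sanity certificate (lead c2): the scalar core `stub_cocycleConformal` is IMPLIED by the crux `Rigidity`

`core_of_rigidity : Rigidity → (statement of stub_cocycleConformal)`: push the avoidance event
through `P D₂ = Φ_* (P D)`; on the `P D`-full event `{γ ⊆ closure D}` injectivity of `Φ` on
`closure D` makes `{Φ γ ⊆ Φ (closure D')}` and `{γ ⊆ closure D'}` coincide. So the reshaped line
cannot be falser than the crux (evidence file, not a proposal).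
-/

namespace Summit.CriticalPhenomena.SAWScalingLimit.Cruxes.Rigidity.Cocycle

open MeasureTheory Set
open Literature.Probability.RandomPlanarGeometry

/-- The scalar core is a consequence of the crux: conformal covariance of `P` makes the avoidance
cocycle conformally invariant along maps injective on the closed domain. [folklore] -/
theorem core_of_rigidity
    (hR : Summit.CriticalPhenomena.SAWScalingLimit.Theses.SAWRestrictionRigidity.Rigidity) :
    ∀ P : Literature.Probability.RandomPlanarGeometry.ChordalFamily, P.IsChordal → P.IsRestriction → (∃ Q : Literature.Probability.RandomPlanarGeometry.DobrushinDomain → Literature.Probability.RandomPlanarGeometry.CurveClass ℂ → MeasureTheory.Measure (Literature.Probability.RandomPlanarGeometry.CurveClass ℂ), P.IsMarkovExtension Q ∧ ∀ (D : Literature.Probability.RandomPlanarGeometry.DobrushinDomain) (p : Literature.Probability.RandomPlanarGeometry.CurveClass ℂ) (D' : Literature.Probability.RandomPlanarGeometry.DobrushinDomain), D'.carrier ⊆ Literature.Probability.RandomPlanarGeometry.remainingDomain D p → D'.pt 0 = p.target → D'.pt 1 = D.pt 1 → ∀ T : Set (Literature.Probability.RandomPlanarGeometry.CurveClass ℂ),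 MeasurableSet T → P D' T * Q D p (Literature.Probability.RandomPlanarGeometry.CurveClass.rangeSubset (closure D'.carrier)) = Q D p (T ∩ Literature.Probability.RandomPlanarGeometry.CurveClass.rangeSubset (closure D'.carrier))) → (∀ D D' : Literature.Probability.RandomPlanarGeometry.DobrushinDomain, D'.carrier = D.carrier → D'.pt 0 = D.pt 1 → D'.pt 1 = D.pt 0 → P D' = (P D).map Literature.Probability.RandomPlanarGeometry.CurveClass.reverse) → (∀ (D : Literature.Probability.RandomPlanarGeometry.DobrushinDomain) (c : ℂ) (hc : c ≠ 0) (w : ℂ), (∃ (r : ℝ) (k : ℕ), 0 < r ∧ c = (r : ℂ) * Complex.I ^ k) → P (D.map (Literature.Probability.RandomPlanarGeometry.similarity c hc w)) = (P D).map (Literature.Probability.RandomPlanarGeometry.CurveClass.map (Literature.Probability.RandomPlanarGeometry.similarity c hc w : C(ℂ, ℂ)))) → (∀ D : Literature.Probability.RandomPlanarGeometry.DobrushinDomain, P (D.map Complex.conjLIE.toHomeomorph) = (P D).map (Literature.Probability.RandomPlanarGeometry.CurveClass.map (Complex.conjLIE.toHomeomorph : C(ℂ, ℂ)))) → (∀ D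 : Literature.Probability.RandomPlanarGeometry.DobrushinDomain, ∀ᵐ γ ∂(P D), γ ∈ Literature.Probability.RandomPlanarGeometry.CurveClass.simple ∧ γ.range ∩ frontier D.carrier ⊆ {D.pt 0, D.pt 1}) → ∀ (D D₂ : Literature.Probability.RandomPlanarGeometry.DobrushinDomain) (g : Literature.Probability.RandomPlanarGeometry.ConformalEquiv D.carrier D₂.carrier) (Φ : C(ℂ, ℂ)), g.HasBoundaryValue (D.pt 0) (D₂.pt 0) → g.HasBoundaryValue (D.pt 1) (D₂.pt 1) → Set.EqOn Φ g D.carrier → Set.InjOn Φ (closure D.carrier) → ∀ (D' D₂' : Literature.Probability.RandomPlanarGeometry.DobrushinDomain), D'.carrier ⊆ D.carrier → D'.pt 0 = D.pt 0 → D'.pt 1 = D.pt 1 → D₂'.carrier ⊆ D₂.carrier → D₂'.pt 0 = D₂.pt 0 → D₂'.pt 1 = D₂.pt 1 → (∃ ε : ℝ, 0 < ε ∧ D'.carrier ∩ Metric.ball (D.pt 0) ε = D.carrier ∩ Metric.ball (D.pt 0) ε ∧ D'.carrier ∩ Metric.ball (D.pt 1) ε = D.carrier ∩ Metric.ball (D.pt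 1) ε) → (∃ ε : ℝ, 0 < ε ∧ D₂'.carrier ∩ Metric.ball (D₂.pt 0) ε = D₂.carrier ∩ Metric.ball (D₂.pt 0) ε ∧ D₂'.carrier ∩ Metric.ball (D₂.pt 1) ε = D₂.carrier ∩ Metric.ball (D₂.pt 1) ε) → Φ '' closure D'.carrier = closure D₂'.carrier → P D (Literature.Probability.RandomPlanarGeometry.CurveClass.rangeSubset (closure D'.carrier)) = P D₂ (Literature.Probability.RandomPlanarGeometry.CurveClass.rangeSubset (closure D₂'.carrier)) := by
  intro P hch hres hmk hrev hsim hconj hsimple D D₂ g Φ hb0 hb1 heq hinj D' D₂' hsub _ _ _ _ _ _ _ hcl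
  have hcc : P.IsConformallyCovariant := hR P hch hres hmk hrev hsim hconj hsimple
  have hΦm : Measurable (CurveClass.map Φ) := CurveClass.measurable_map Φ
  rw [hcc D D₂ g Φ hb0 hb1 heq, Measure.map_apply hΦm (CurveClass.measurableSet_rangeSubset isClosed_closure)]
  refine measure_congr ?_
  have hfull : ∀ᵐ γ ∂(P D), γ.range ⊆ closure D.carrier := by
    filter_upwards [(hch D).2] with γ hγ using hγ.2.2
  filter_upwards [hfull] with γ hγ
  -- membership in the two events agrees for curves inside `closure D`
  have key : (γ ∈ CurveClass.rangeSubset (closure D'.carrier)) ↔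
      (γ ∈ CurveClass.map Φ ⁻¹' CurveClass.rangeSubset (closure D₂'.carrier)) := by
    rw [mem_preimage, CurveClass.mem_rangeSubset, CurveClass.mem_rangeSubset, CurveClass.range_map,
      ← hcl]
    constructor
    · intro h
      exact image_mono h
    · intro h x hx
      obtain ⟨y, hy, hyx⟩ := h (mem_image_of_mem _ hx)
      have hyD : y ∈ closure D.carrier := closure_mono hsub hy
      rwa [← hinj hyD (hγ hx) hyx]
  exact propext key

end Summit.CriticalPhenomena.SAWScalingLimit.Cruxes.Rigidity.Cocycle
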